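import Literature.Computability.AlgebraicComplexity.FlipGraphConnectivity
import Literature.Computability.AlgebraicComplexity.MatMulLieIsotropy
import Literature.Computability.AlgebraicComplexity.KroneckerRank
import HarnessLib

/-!
# Kauers–Moosbauer flip graphs: the symmetry group, orbits, invariant schemes

Topic `Literature/Computability/AlgebraicComplexity`; companion of `FlipGraphConnectivity.lean`
(KM Def. 8 with vertices the schemes, `AdjQuot` for any equivalence on schemes, Thm. 9). Sources:
Kauers–Moosbauer ISSAC 2023 (KM) §2 — "These transformations generate the symmetry group of
`M_{n,m,p}` … two schemes equivalent if they belong to the same orbit", Def. 8 "Let `V` be the set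
of all orbits … under the symmetry group" —; Moosbauer–Poole ISSAC 2025 (MP) §2 — "The group `S₃`
acts by permuting the three factors and transposing them if the permutation is odd. An element
`(U,V,W) ∈ GL(n)³` acts … by the so-called sandwiching action", Def. 2 (`G`-invariant schemes) —;
de Groote 1978 (the isotropy group of `⟨n,n,n⟩`). Everything here is PROVED; no named facts.

## Contents

* `Symmetry t` — a symmetry of the 3-tensor `t`: a `K`-linear automorphism of the tensor space
  fixing `t` and mapping rank-one tensors to rank-one tensors (both ways). For `t = ⟨n,n,n⟩` the
  maps below (sandwiches, transposition, cyclic shift) are symmetries, and KM §2 / MP §2 call the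
  group they generate the symmetry group of matrix multiplication (de Groote: it is the whole
  isotropy group). `Symmetry.refl/symm/trans`.
* `Scheme.map φ` — a symmetry maps schemes to schemes of the same rank (KM: "maps a correct scheme
  to another correct scheme"); `orbitSetoid t` — "two schemes equivalent if they belong to the same
  orbit"; `IsInvariantUnder G S` — MP Def. 2, `G`-invariant schemes (`g • S = S` for all `g ∈ G`).
* The symmetries of `⟨n,n,n⟩ = matMulTensor K n n n` in the tree's coordinates (slots
  `(Z, X, Y)` = (output `Z_{κν}`, `X_{κμ}`, `Y_{μν}`); KM write `A ⊗ B ⊗ Γ` with `A = X`, `B = Y` and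
  the third factor TRANSPOSED, `Γ = Zᵀ`):
  - `Symmetry.sandwich P Q R` — de Groote's sandwiches `(P⁻ᵀ ⊗ R⁻ᵀ, P ⊗ Q, Q⁻ᵀ ⊗ R)`
    (`actTensor_sandwich_matMulTensor`), KM: "`A⊗B⊗Γ ↦ AU⊗U⁻¹B⊗Γ` maps a correct scheme to another";
  - `Symmetry.transposeSq` — KM: "exchanging each `A⊗B⊗Γ` by `Bᵀ⊗Aᵀ⊗Γᵀ`"; in tree slots
    `(Z,X,Y) ↦ (Zᵀ,Yᵀ,Xᵀ)` (`(XY)ᵀ = YᵀXᵀ`, Bläser Lemma 5.5);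
  - `Symmetry.cycleSq` — KM: "replace every `A⊗B⊗Γ` by `B⊗Γ⊗A`"; in tree slots
    `(Z,X,Y) ↦ (Xᵀ,Y,Zᵀ)`.
* `flipGraphOrbits` = `AdjQuot (orbitSetoid t)` — **KM Def. 8 verbatim** (vertices = orbits under the
  symmetry group) and `kauersMoosbauer2023_thm9_orbits` — Thm. 9 for it.

Faithfulness note. `Symmetry t` is the stabiliser of `t` among the `K`-linear automorphisms of the
tensor space that preserve the set of rank-one tensors; for `t = ⟨n,n,n⟩` it CONTAINS the group
generated by the sandwiches, the transposition and the cyclic shift (§2), which is the group KM and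
MP work with; that the two coincide (de Groote 1978: the isotropy group of `⟨n,n,n⟩` is generated by
these maps) is NOT proved here, so `orbitSetoid ⟨n,n,n⟩` is KM's orbit relation granted that
theorem. Thm. 9 holds for every equivalence on schemes anyway (`kauersMoosbauer2023_thm9_quot`).
Also not here: equivariance of flips/reductions under symmetries (not needed for Def. 8, whose
edges between orbits are induced by edges between representatives).

## References

* M. Kauers, J. Moosbauer, *Flip Graphs for Matrix Multiplication*, ISSAC 2023, arXiv:2212.01175,
  §2 (symmetry group, equivalence of schemes), Def. 8. [KauersMoosbauer2022FlipGraphs]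
* J. Moosbauer, M. Poole, *Flip Graphs with Symmetry and New Matrix Multiplication Schemes*,
  ISSAC 2025, arXiv:2502.04514, §2 and Def. 2. [MoosbauerPoole2025]
* H. F. de Groote, *On varieties of optimal algorithms for the computation of bilinear mappings. I*,
  Theoret. Comput. Sci. 7 (1978) 1–24, §3. [Degroote1978]
* M. Bläser, *Fast Matrix Multiplication*, Theory of Computing Graduate Surveys 5 (2013), Lemma 5.5.
  [Blaser2013]
-/

namespace Literature.Computability.AlgebraicComplexity

open scoped BigOperators Kronecker
open Multiset Matrix

namespace FlipGraph

/-! ## §1 Symmetries of a tensor, their action on schemes, orbits -/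

section Symmetry

variable {K : Type*} [Field K] {ι κ μ : Type*}

/-- **A symmetry of the 3-tensor `t`**: a `K`-linear automorphism `φ` of `K^{ι×κ×μ}` with `φ t = t`
that maps rank-one tensors `A ⊗ B ⊗ Γ` to rank-one tensors, as does its inverse. For
`t = M_{n,m,p}` the sandwiches, the transposition and the cyclic shift of KM §2 are symmetries
(§2 below); "These transformations generate the symmetry group of `M_{n,m,p}`" (KM §2; de Groote
1978: the isotropy group). [cite: KauersMoosbauer2022FlipGraphs, §2 (symmetry group)] -/
structure Symmetry (t : ι → κ → μ → K) where
  /-- the underlying linear automorphism of the tensor space -/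
  toLinearEquiv : (ι → κ → μ → K) ≃ₗ[K] (ι → κ → μ → K)
  /-- it fixes `t` -/
  map_self : toLinearEquiv t = t
  /-- it maps rank-one tensors to rank-one tensors -/
  map_triad : ∀ (a : ι → K) (b : κ → K) (c : μ → K),
    ∃ (a' : ι → K) (b' : κ → K) (c' : μ → K), toLinearEquiv (triad a b c) = triad a' b' c'
  /-- … and so does its inverse -/
  symm_map_triad : ∀ (a : ι → K) (b : κ → K) (c : μ → K),
    ∃ (a' : ι → K) (b' : κ → K) (c' : μ → K), toLinearEquiv.symm (triad a b c) = triad a' b' c'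

variable {t : ι → κ → μ → K}

/-- Two schemes with the same elements are equal (bookkeeping). [folklore] -/
private theorem scheme_ext {x y : Scheme t} (h : x.elts = y.elts) : x = y := by
  cases x; cases y; cases h; rfl

namespace Symmetry

/-- The identity symmetry. [cite: KauersMoosbauer2022FlipGraphs, §2 (symmetry group)] -/
def refl (t : ι → κ → μ → K) : Symmetry t where
  toLinearEquiv := LinearEquiv.refl K _
  map_self := rfl
  map_triad a b c := ⟨a, b, c, rfl⟩
  symm_map_triad a b c := ⟨a, b, c, rfl⟩

/-- The inverse of a symmetry. [cite: KauersMoosbauer2022FlipGraphs, §2 (symmetry group)] -/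
def symm (φ : Symmetry t) : Symmetry t where
  toLinearEquiv := φ.toLinearEquiv.symm
  map_self := by
    have h := congrArg φ.toLinearEquiv.symm φ.map_self
    rw [LinearEquiv.symm_apply_apply] at h
    exact h.symm
  map_triad := φ.symm_map_triad
  symm_map_triad a b c := by
    rw [LinearEquiv.symm_symm]
    exact φ.map_triad a b c

/-- Composition of symmetries. [cite: KauersMoosbauer2022FlipGraphs, §2 (symmetry group)] -/
def trans (φ ψ : Symmetry t) : Symmetry t where
  toLinearEquiv := φ.toLinearEquiv.trans ψ.toLinearEquiv
  map_self := by rw [LinearEquiv.trans_apply, φ.map_self, ψ.map_self]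
  map_triad a b c := by
    obtain ⟨a', b', c', h⟩ := φ.map_triad a b c
    obtain ⟨a'', b'', c'', h'⟩ := ψ.map_triad a' b' c'
    exact ⟨a'', b'', c'', by rw [LinearEquiv.trans_apply, h, h']⟩
  symm_map_triad a b c := by
    obtain ⟨a', b', c', h⟩ := ψ.symm_map_triad a b c
    obtain ⟨a'', b'', c'', h'⟩ := φ.symm_map_triad a' b' c'
    exact ⟨a'', b'', c'', by rw [LinearEquiv.symm_trans_apply, h, h']⟩

end Symmetry

/-- **A symmetry maps schemes to schemes** ("maps a correct scheme to another correct scheme",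
KM §2): the image multiset `{φ T : T ∈ S}` is again a scheme of `t`.
[cite: KauersMoosbauer2022FlipGraphs, §2 (symmetry group)] -/
def Scheme.map (φ : Symmetry t) (S : Scheme t) : Scheme t where
  elts := S.elts.map φ.toLinearEquiv
  ne_zero T hT := by
    obtain ⟨U, hU, rfl⟩ := Multiset.mem_map.mp hT
    exact fun h => S.ne_zero U hU (φ.toLinearEquiv.map_eq_zero_iff.mp h)
  exists_triad T hT := by
    obtain ⟨U, hU, rfl⟩ := Multiset.mem_map.mp hT
    obtain ⟨a, b, c, rfl⟩ := S.exists_triad U hU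
    exact φ.map_triad a b c
  sum_eq := by rw [← map_multiset_sum, S.sum_eq, φ.map_self]

/-- The elements of the image scheme. [cite: KauersMoosbauer2022FlipGraphs, §2 (symmetry group)] -/
@[simp] theorem Scheme.map_elts (φ : Symmetry t) (S : Scheme t) :
    (S.map φ).elts = S.elts.map φ.toLinearEquiv := rfl

/-- A symmetry preserves the rank of a scheme (equivalent schemes lie in the same level).
[cite: KauersMoosbauer2022FlipGraphs, §2 and Def. 8] -/
theorem Scheme.rank_map (φ : Symmetry t) (S : Scheme t) : (S.map φ).rank = S.rank := by
  simp [Scheme.rank]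

/-- Mapping by the identity. [cite: KauersMoosbauer2022FlipGraphs, §2 (symmetry group)] -/
theorem Scheme.map_refl (S : Scheme t) : S.map (Symmetry.refl t) = S :=
  scheme_ext (by simp [Symmetry.refl])

/-- Mapping by a composite. [cite: KauersMoosbauer2022FlipGraphs, §2 (symmetry group)] -/
theorem Scheme.map_trans (φ ψ : Symmetry t) (S : Scheme t) :
    S.map (φ.trans ψ) = (S.map φ).map ψ :=
  scheme_ext (by simp [Symmetry.trans, Multiset.map_map])

/-- Mapping back by the inverse. [cite: KauersMoosbauer2022FlipGraphs, §2 (symmetry group)] -/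
theorem Scheme.map_map_symm (φ : Symmetry t) (S : Scheme t) : (S.map φ).map φ.symm = S :=
  scheme_ext (by simp [Symmetry.symm, Multiset.map_map])

/-- **"Two schemes are equivalent if they belong to the same orbit"** (KM §2): the orbit relation
of the symmetries of `t` on its schemes, an equivalence relation.
[cite: KauersMoosbauer2022FlipGraphs, §2 (equivalence of schemes)] -/
def orbitSetoid (t : ι → κ → μ → K) : Setoid (Scheme t) where
  r S S' := ∃ φ : Symmetry t, S' = S.map φ
  iseqv :=
    { refl := fun S => ⟨Symmetry.refl t, (Scheme.map_refl S).symm⟩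
      symm := by
        rintro S S' ⟨φ, rfl⟩
        exact ⟨φ.symm, (Scheme.map_map_symm φ S).symm⟩
      trans := by
        rintro S S' S'' ⟨φ, rfl⟩ ⟨ψ, rfl⟩
        exact ⟨φ.trans ψ, (Scheme.map_trans φ ψ S).symm⟩ }

/-- **MP Def. 2 (`G`-invariant scheme):** "Let `G` be a subgroup of the symmetry group of matrix
multiplication. A matrix multiplication scheme `S` is called `G`-invariant if for all `g ∈ G` we
have `g · S = S`" — here for any set `G` of symmetries of `t` (Burichenko: `G ≤ Aut(S)`).
[cite: MoosbauerPoole2025, Def. 2] -/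
def IsInvariantUnder (G : Set (Symmetry t)) (S : Scheme t) : Prop :=
  ∀ φ ∈ G, S.map φ = S

/-- **KM Def. 8 — the flip graph on ORBITS:** "Let `V` be the set of all orbits of
`(n,m,p)`-matrix multiplication schemes under the symmetry group and define
`E₁ = {(S,S') | S' is a flip of S}`, `E₂ = {(S,S') | S' is a reduction of S}`"; the graph
`(V, E₁ ∪ E₂)` with edges between orbits induced by edges between representatives
(`AdjQuot` of `FlipGraphConnectivity.lean` at the orbit relation of the symmetries of `t`; see the
faithfulness note in the module docstring for the identification with KM's group).
[cite: KauersMoosbauer2022FlipGraphs, Def. 8] -/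
def flipGraphOrbits (t : ι → κ → μ → K) :
    Quotient (orbitSetoid t) → Quotient (orbitSetoid t) → Prop :=
  AdjQuot (orbitSetoid t)

/-- **KM Thm. 9 for the flip graph on orbits** of `(k,m,n)`-schemes over a field: weakly connected.
[cite: KauersMoosbauer2022FlipGraphs, Thm. 9] -/
theorem kauersMoosbauer2023_thm9_orbits (k m n : ℕ)
    (p q : Quotient (orbitSetoid (matMulTensor K k m n))) :
    Relation.EqvGen (flipGraphOrbits (matMulTensor K k m n)) p q :=
  kauersMoosbauer2023_thm9_quot k m n _ p q

end Symmetry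

/-! ## §2 The symmetries of `⟨n,n,n⟩`: sandwiches, transposition, cyclic shift -/

section MatMul

variable {K : Type*} [Field K]

/-- `(A ⊗ B ⊗ C)·(r • t) = r • (A ⊗ B ⊗ C)·t` (bookkeeping). [folklore] -/
private theorem actTensor_smul_tensor {ι κ μ ι' κ' μ' : Type*} [Fintype ι] [Fintype κ]
    [Fintype μ] (A : Matrix ι' ι K) (B : Matrix κ' κ K) (C : Matrix μ' μ K) (r : K)
    (s : ι → κ → μ → K) : actTensor A B C (r • s) = r • actTensor A B C s := by
  funext a b c
  simp only [actTensor_apply, Pi.smul_apply, smul_eq_mul, Finset.mul_sum]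
  refine Finset.sum_congr rfl fun a' _ => Finset.sum_congr rfl fun b' _ =>
    Finset.sum_congr rfl fun c' _ => ?_
  ring

/-- **A factorwise change of bases fixing `t` is a symmetry:** for matrices `A, B, C` with two-sided
inverses `A', B', C'` and `(A ⊗ B ⊗ C)·t = t`, the map `T ↦ (A ⊗ B ⊗ C)·T` is a symmetry of `t`
(it maps `a ⊗ b ⊗ c` to `Aa ⊗ Bb ⊗ Cc`). [cite: KauersMoosbauer2022FlipGraphs, §2 (symmetry group)] -/
noncomputable def Symmetry.ofAct {ι κ μ : Type*} [Fintype ι] [Fintype κ] [Fintype μ]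
    [DecidableEq ι] [DecidableEq κ] [DecidableEq μ] {t : ι → κ → μ → K}
    (A A' : Matrix ι ι K) (B B' : Matrix κ κ K) (C C' : Matrix μ μ K)
    (hA : A * A' = 1) (hA' : A' * A = 1) (hB : B * B' = 1) (hB' : B' * B = 1) (hC : C * C' = 1)
    (hC' : C' * C = 1) (ht : actTensor A B C t = t) : Symmetry t where
  toLinearEquiv :=
    LinearEquiv.ofLinear
      { toFun := actTensor A B C
        map_add' := actTensor_add_tensor A B C
        map_smul' := fun r s => by rw [RingHom.id_apply]; exact actTensor_smul_tensor A B C r s }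
      { toFun := actTensor A' B' C'
        map_add' := actTensor_add_tensor A' B' C'
        map_smul' := fun r s => by
          rw [RingHom.id_apply]; exact actTensor_smul_tensor A' B' C' r s }
      (LinearMap.ext fun T => by
        simp only [LinearMap.comp_apply, LinearMap.coe_mk, AddHom.coe_mk, LinearMap.id_apply,
          actTensor_actTensor, hA, hB, hC, actTensor_one])
      (LinearMap.ext fun T => by
        simp only [LinearMap.comp_apply, LinearMap.coe_mk, AddHom.coe_mk, LinearMap.id_apply,
          actTensor_actTensor, hA', hB', hC', actTensor_one])
  map_self := ht
  map_triad a b c := ⟨A.mulVec a, B.mulVec b, C.mulVec c, actTensor_triad A B C a b c⟩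
  symm_map_triad a b c := ⟨A'.mulVec a, B'.mulVec b, C'.mulVec c, actTensor_triad A' B' C' a b c⟩

variable {n : ℕ}

/-- **The sandwich symmetries of `⟨n,n,n⟩`** (de Groote 1978; KM §2: "if `U` is invertible, then
… replacing every rank-one tensor `A⊗B⊗Γ` by `AU⊗U⁻¹B⊗Γ` maps a correct scheme to another one";
MP §2: "`(U,V,W)·A⊗B⊗C = UAV⁻¹ ⊗ VBW⁻¹ ⊗ WCU⁻¹`"): for invertible `P, Q, R` the change of bases
`X ↦ PXQᵀ`, `Y ↦ Q⁻ᵀYRᵀ`, `Z ↦ P⁻ᵀZR⁻¹`, i.e. `(P⁻ᵀ ⊗ₖ R⁻ᵀ, P ⊗ₖ Q, Q⁻ᵀ ⊗ₖ R)` on the slots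
`(Z, X, Y)`, is a symmetry of `⟨n,n,n⟩` (`actTensor_sandwich_matMulTensor`).
[cite: Degroote1978, §3] -/
noncomputable def Symmetry.sandwich (P Q R : Matrix (Fin n) (Fin n) K) (hP : IsUnit P.det)
    (hQ : IsUnit Q.det) (hR : IsUnit R.det) : Symmetry (matMulTensor K n n n) :=
  Symmetry.ofAct (P⁻¹ᵀ ⊗ₖ R⁻¹ᵀ) (Pᵀ ⊗ₖ Rᵀ) (P ⊗ₖ Q) (P⁻¹ ⊗ₖ Q⁻¹) (Q⁻¹ᵀ ⊗ₖ R) (Qᵀ ⊗ₖ R⁻¹)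
    (by rw [← mul_kronecker_mul, ← transpose_mul, ← transpose_mul, mul_nonsing_inv _ hP,
      mul_nonsing_inv _ hR, transpose_one, one_kronecker_one])
    (by rw [← mul_kronecker_mul, ← transpose_mul, ← transpose_mul, nonsing_inv_mul _ hP,
      nonsing_inv_mul _ hR, transpose_one, one_kronecker_one])
    (by rw [← mul_kronecker_mul, mul_nonsing_inv _ hP, mul_nonsing_inv _ hQ, one_kronecker_one])
    (by rw [← mul_kronecker_mul, nonsing_inv_mul _ hP, nonsing_inv_mul _ hQ, one_kronecker_one])
    (by rw [← mul_kronecker_mul, ← transpose_mul, mul_nonsing_inv _ hQ, mul_nonsing_inv _ hR,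
      transpose_one, one_kronecker_one])
    (by rw [← mul_kronecker_mul, ← transpose_mul, nonsing_inv_mul _ hQ, nonsing_inv_mul _ hR,
      transpose_one, one_kronecker_one])
    (actTensor_sandwich_matMulTensor P Q R hP hQ hR)

/-- The transposition map on `K^{(n×n)×(n×n)×(n×n)}` in the tree's slots `(Z, X, Y)`:
`(τ T)(a, b, c) = T(aᵀ, cᵀ, bᵀ)`, so that `τ (z ⊗ x ⊗ y) = zᵀ ⊗ yᵀ ⊗ xᵀ`.
[cite: KauersMoosbauer2022FlipGraphs, §2 (symmetry group)] -/
def transposeMap (n : ℕ) (T : (Fin n × Fin n) → (Fin n × Fin n) → (Fin n × Fin n) → K) :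
    (Fin n × Fin n) → (Fin n × Fin n) → (Fin n × Fin n) → K :=
  fun a b c => T a.swap c.swap b.swap

/-- The cyclic-shift map in the tree's slots `(Z, X, Y)`: `(ρ T)(a, b, c) = T(cᵀ, aᵀ, b)`, so that
`ρ (z ⊗ x ⊗ y) = xᵀ ⊗ y ⊗ zᵀ`. [cite: KauersMoosbauer2022FlipGraphs, §2 (symmetry group)] -/
def cycleMap (n : ℕ) (T : (Fin n × Fin n) → (Fin n × Fin n) → (Fin n × Fin n) → K) :
    (Fin n × Fin n) → (Fin n × Fin n) → (Fin n × Fin n) → K :=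
  fun a b c => T c.swap a.swap b

/-- The inverse cyclic shift: `(ρ⁻¹ T)(a, b, c) = T(bᵀ, c, aᵀ)`.
[cite: KauersMoosbauer2022FlipGraphs, §2 (symmetry group)] -/
def cycleMapInv (n : ℕ) (T : (Fin n × Fin n) → (Fin n × Fin n) → (Fin n × Fin n) → K) :
    (Fin n × Fin n) → (Fin n × Fin n) → (Fin n × Fin n) → K :=
  fun a b c => T b.swap c a.swap

/-- `τ` on rank-one tensors: `z ⊗ x ⊗ y ↦ zᵀ ⊗ yᵀ ⊗ xᵀ` — KM's "`A⊗B⊗Γ ↦ Bᵀ⊗Aᵀ⊗Γᵀ`" with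
`A = x`, `B = y`, `Γ = zᵀ`. [cite: KauersMoosbauer2022FlipGraphs, §2 (symmetry group)] -/
theorem transposeMap_triad (z x y : Fin n × Fin n → K) :
    transposeMap n (triad z x y) =
      triad (fun p => z p.swap) (fun p => y p.swap) (fun p => x p.swap) := by
  funext a b c
  simp only [transposeMap, triad_apply]
  ring

/-- `ρ` on rank-one tensors: `z ⊗ x ⊗ y ↦ xᵀ ⊗ y ⊗ zᵀ` — KM's "`A⊗B⊗Γ ↦ B⊗Γ⊗A`" with `A = x`,
`B = y`, `Γ = zᵀ` (new `A = y`, new `B = Γ = zᵀ`, new `Γ = x`, i.e. new `Z = xᵀ`).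
[cite: KauersMoosbauer2022FlipGraphs, §2 (symmetry group)] -/
theorem cycleMap_triad (z x y : Fin n × Fin n → K) :
    cycleMap n (triad z x y) = triad (fun p => x p.swap) y (fun p => z p.swap) := by
  funext a b c
  simp only [cycleMap, triad_apply]
  ring

/-- `ρ⁻¹` on rank-one tensors. [cite: KauersMoosbauer2022FlipGraphs, §2 (symmetry group)] -/
theorem cycleMapInv_triad (z x y : Fin n × Fin n → K) :
    cycleMapInv n (triad z x y) = triad (fun p => y p.swap) (fun p => z p.swap) x := by
  funext a b c
  simp only [cycleMapInv, triad_apply]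
  ring

/-- `τ` fixes `⟨n,n,n⟩`: `(XY)ᵀ = YᵀXᵀ` (Bläser 2013, Lemma 5.5; `matMulTensor_transpose`).
[cite: Blaser2013, Lemma 5.5] -/
theorem transposeMap_matMulTensor : transposeMap n (matMulTensor K n n n) = matMulTensor K n n n := by
  funext a b c
  rw [transposeMap, ← matMulTensor_transpose]

/-- `ρ` fixes `⟨n,n,n⟩`: `tr(XYZᵀ) = tr(YZᵀX)` (Bläser 2013, Lemma 5.5; `matMulTensor_rotate`).
[cite: Blaser2013, Lemma 5.5] -/
theorem cycleMap_matMulTensor : cycleMap n (matMulTensor K n n n) = matMulTensor K n n n := by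
  funext a b c
  rw [cycleMap, matMulTensor_rotate K n n n a.swap b c.swap, Prod.swap_swap, Prod.swap_swap]

/-- **KM's transposition symmetry** of `⟨n,n,n⟩`: "exchanging each rank-one tensor `A⊗B⊗Γ` by
`Bᵀ⊗Aᵀ⊗Γᵀ` maps a correct scheme to another correct scheme" (MP: the odd elements of `S₃` act
"by permuting the three factors and transposing them"). [cite: KauersMoosbauer2022FlipGraphs, §2 (symmetry group)] -/
def Symmetry.transposeSq (n : ℕ) : Symmetry (matMulTensor K n n n) where
  toLinearEquiv :=
    { toFun := transposeMap n
      map_add' := fun _ _ => by funext a b c; rfl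
      map_smul' := fun _ _ => by funext a b c; rfl
      invFun := transposeMap n
      left_inv := fun T => by funext a b c; simp [transposeMap]
      right_inv := fun T => by funext a b c; simp [transposeMap] }
  map_self := transposeMap_matMulTensor
  map_triad z x y := ⟨_, _, _, transposeMap_triad z x y⟩
  symm_map_triad z x y := ⟨_, _, _, transposeMap_triad z x y⟩

/-- **KM's cyclic symmetry** of `⟨n,n,n⟩`: "A correct scheme is also obtained if we replace every
rank-one tensor `A⊗B⊗Γ` by `B⊗Γ⊗A`" (MP: `C₃ ≤ S₃` permuting the factors).
[cite: KauersMoosbauer2022FlipGraphs, §2 (symmetry group)] -/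
def Symmetry.cycleSq (n : ℕ) : Symmetry (matMulTensor K n n n) where
  toLinearEquiv :=
    { toFun := cycleMap n
      map_add' := fun _ _ => by funext a b c; rfl
      map_smul' := fun _ _ => by funext a b c; rfl
      invFun := cycleMapInv n
      left_inv := fun T => by funext a b c; simp [cycleMap, cycleMapInv]
      right_inv := fun T => by funext a b c; simp [cycleMap, cycleMapInv] }
  map_self := cycleMap_matMulTensor
  map_triad z x y := ⟨_, _, _, cycleMap_triad z x y⟩
  symm_map_triad z x y := ⟨_, _, _, cycleMapInv_triad z x y⟩

/-- The image of a scheme of `⟨n,n,n⟩` under a sandwich is a scheme of `⟨n,n,n⟩` of the same rank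
(KM §2, written out). [cite: KauersMoosbauer2022FlipGraphs, §2 (symmetry group)] -/
theorem rank_map_sandwich (P Q R : Matrix (Fin n) (Fin n) K) (hP : IsUnit P.det)
    (hQ : IsUnit Q.det) (hR : IsUnit R.det) (S : Scheme (matMulTensor K n n n)) :
    (S.map (Symmetry.sandwich P Q R hP hQ hR)).rank = S.rank :=
  Scheme.rank_map _ S

end MatMul

end FlipGraph

end Literature.Computability.AlgebraicComplexity
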